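import Summits.QuantumFields.YangMills.Theorems.BalabanLadderUVSeamRecColdWallGauge
import HarnessLib

/-!
# Crux `UVSeamRec` (stmt-QuantumFields-20043): the DEEP TEMPORAL COMB of a cold-wall cube is gauge-fixable —
# `exp(−8βr²#P_Λ) · φ_ρ(r)^{#(Λ ∖ T)} ≤ Z_Λ(β; 𝟙)` for every cube `Λ = cubeEdges c b`

Helper file (`--supports stmt-QuantumFields-20043`) of the LEAD seat `ym-spine-20043-p1` (gen 12); instantiates the abstract gauge-fixing lemma
`…ColdWallGauge.fibreIntegral_exp_neg_mul_one_ge_of_gauge` for the cube `(c, b)` of `ℤ⁴`.  DEEP sites: `c j + 1 ≤ x j ≤ c j + b − 2` for all `j`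
(all eight neighbours are cube sites, so all eight links at a deep site are interior and the kernel `γ_Λ(· | 𝟙)` is invariant under gauge
transformations supported there); TREE `T`: the time-like links `(y, 3)` with `y + e₃` deep.  The gauge transformation `g ζ` is the ordered product
of the link variables up the time column from the floor of the cube to the deep site (`colProd`, a `Nat.rec`); it is `1` off the deep sites,
measurable, determined by the `T`-coordinates, and kills every link of `T` (`(g ζ · (ζ ∨ 𝟙))(y, 3) = g(y) ζ(y,3) g(y + e₃)⁻¹ = 1`).  Main result
**`fibreIntegral_exp_neg_mul_one_cube_ge`**; with `…ColdWallComb.fibreIntegral_exp_neg_mul_cube_le_pow` (same exponent `#(Λ ∖ T)`) the `log β`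
of gen 11's box ceiling cancels in the chord `[β/2, β]` (sequel `…ColdWallBoxCeilingSharp`).
HONEST FRAMING: bookkeeping of an axial gauge in one cube; nothing of E0′, NT or the gap; not Clay.
-/

open MeasureTheory Finset
open scoped ENNReal Matrix Matrix.Norms.Frobenius
open Literature.MathematicalPhysics.QuantumFieldTheory (haarProbability)
open Literature.MathematicalPhysics.QuantumLattice
open Literature.Probability.LatticeModels (glueWith glueWith_apply_mem glueWith_apply_not_mem measurable_glueWith)
open Summit.QuantumFields.YangMills.Cruxes.OSLegsFromFemtoAndGap.DlrCollarTransfer (cubeSites cubeEdges)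

noncomputable section

namespace Summit.QuantumFields.YangMills.Cruxes.UVSeamRec.ClassicalResponse.ColdWall

section Cube

variable {N : ℕ} {G : Type*} [Group G] [TopologicalSpace G] [IsTopologicalGroup G] [CompactSpace G]
  [MeasurableSpace G] [BorelSpace G] [SecondCountableTopology G] (ρ : G →* Matrix (Fin N) (Fin N) ℂ)

omit [TopologicalSpace G] [IsTopologicalGroup G] [CompactSpace G] [MeasurableSpace G] [BorelSpace G] [SecondCountableTopology G] in
/-- Membership of a link in `cubeEdges c b`, in coordinates (both endpoints in `∏ [c_j, c_j + b)`). [folklore] -/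
theorem mem_cubeEdges_iff_forall (c : Fin 4 → ℤ) (b : ℕ) (x : Fin 4 → ℤ) (i : Fin 4) :
    (x, i) ∈ cubeEdges c b ↔ (∀ j, c j ≤ x j ∧ x j < c j + b) ∧
      ∀ j, c j ≤ x j + (if j = i then 1 else 0) ∧ x j + (if j = i then 1 else 0) < c j + b := by
  unfold cubeEdges cubeSites
  simp only [Finset.mem_filter, Finset.mem_product, Finset.mem_univ, and_true, Fintype.mem_piFinset, Finset.mem_Ico, Pi.add_apply,
    Pi.single_apply]

/-- **GAUGE-FIXED LOWER BOUND ON THE COLD-WALL CUBE FIBRE INTEGRAL.**  For a compact second-countable `G`, a continuous unitary representation `ρ`,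
every cube `(c, b)` of `ℤ⁴` (interior links `Λ`, deep temporal comb `T`), `β ≥ 0` and `r > 0`:
`exp(−8βr²·#P_Λ) · φ_ρ(r)^{#(Λ ∖ T)} ≤ ∫ exp(−β S_Λ(ζ ∨ 𝟙)) dHaar^Λ(ζ)` — the axial gauge up the time columns of the deep sites satisfies the four
hypotheses of `fibreIntegral_exp_neg_mul_one_ge_of_gauge`. [folklore] -/
theorem fibreIntegral_exp_neg_mul_one_cube_ge (hρ : Continuous ρ) (hρU : ∀ g, ρ g ∈ Matrix.unitaryGroup (Fin N) ℂ) (c : Fin 4 → ℤ) (b : ℕ)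
    {β : ℝ} (hβ : 0 ≤ β) {r : ℝ} (hr : 0 < r) :
    Real.exp (-(8 * β * r ^ 2 * (plaquettesTouching (cubeEdges c b)).card)) *
        (haarProbability G).real {g : G | ‖ρ g - 1‖ ≤ r} ^
          (cubeEdges c b \ (cubeEdges c b).filter (fun ℓ => ℓ.2 = 3 ∧
            ∀ j, c j + 1 ≤ (ℓ.1 + Pi.single 3 1 : Fin 4 → ℤ) j ∧ (ℓ.1 + Pi.single 3 1 : Fin 4 → ℤ) j + 2 ≤ c j + b)).card ≤
      ∫ ζ, Real.exp (-β * wilsonBoundaryAction ρ (cubeEdges c b) (glueWith (cubeEdges c b) ζ (fun _ => 1)))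
        ∂(Measure.pi fun _ : ↥(cubeEdges c b) => haarProbability G) := by
  set Λ := cubeEdges c b with hΛ
  -- deep sites and the column product up the time direction
  let D : (Fin 4 → ℤ) → Prop := fun x => ∀ j, c j + 1 ≤ x j ∧ x j + 2 ≤ c j + b
  let e₃ : Fin 4 → ℤ := Pi.single 3 1
  let R : (↥Λ → G) → ℕ → (Fin 4 → ℤ) → G := fun ζ =>
    Nat.rec (motive := fun _ => (Fin 4 → ℤ) → G) (fun _ => 1) (fun _ ih y => ih (y - e₃) * glueWith Λ ζ (fun _ => 1) (y - e₃, 3))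
  let g : (↥Λ → G) → (Fin 4 → ℤ) → G := fun ζ x => if D x then R ζ (x 3 - c 3).toNat x else 1
  have hR0 : ∀ (ζ : ↥Λ → G) (y : Fin 4 → ℤ), R ζ 0 y = 1 := fun _ _ => rfl
  have hRs : ∀ (ζ : ↥Λ → G) (n : ℕ) (y : Fin 4 → ℤ), R ζ (n + 1) y = R ζ n (y - e₃) * glueWith Λ ζ (fun _ => 1) (y - e₃, 3) :=
    fun _ _ _ => rfl
  have he₃ : ∀ (y : Fin 4 → ℤ) (j : Fin 4), (y - e₃) j = y j - if j = 3 then 1 else 0 := fun y j => by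
    simp only [e₃, Pi.sub_apply, Pi.single_apply]
  have he₃' : ∀ (y : Fin 4 → ℤ) (j : Fin 4), (y + e₃) j = y j + if j = 3 then 1 else 0 := fun y j => by
    simp only [e₃, Pi.add_apply, Pi.single_apply]
  -- links below deep sites are tree links, in particular interior links
  have hlink : ∀ y : Fin 4 → ℤ, (∀ j, j ≠ 3 → c j + 1 ≤ y j ∧ y j + 2 ≤ c j + b) → c 3 ≤ y 3 → y 3 + 3 ≤ c 3 + b →
      (y, (3 : Fin 4)) ∈ Λ := by
    intro y hsp h1 h2
    rw [hΛ, mem_cubeEdges_iff_forall]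
    refine ⟨fun j => ?_, fun j => ?_⟩
    · by_cases hj : j = 3
      · subst hj; omega
      · have := hsp j hj; omega
    · by_cases hj : j = 3
      · subst hj; rw [if_pos rfl]; omega
      · have := hsp j hj; rw [if_neg hj]; omega
  -- (ii) `R ζ n y` only reads tree links
  have hRT : ∀ (ζ ζ' : ↥Λ → G), (∀ ℓ : ↥Λ, ℓ.1 ∈ Λ.filter (fun ℓ => ℓ.2 = 3 ∧
      ∀ j, c j + 1 ≤ (ℓ.1 + Pi.single 3 1 : Fin 4 → ℤ) j ∧ (ℓ.1 + Pi.single 3 1 : Fin 4 → ℤ) j + 2 ≤ c j + b) → ζ ℓ = ζ' ℓ) →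
      ∀ (n : ℕ) (y : Fin 4 → ℤ), (∀ j, j ≠ 3 → c j + 1 ≤ y j ∧ y j + 2 ≤ c j + b) → y 3 = c 3 + n → y 3 + 2 ≤ c 3 + b →
        R ζ n y = R ζ' n y := by
    intro ζ ζ' hζ n
    induction' n with n ih
    · intro y _ _ _; rw [hR0, hR0]
    · intro y hsp hy3 hyb
      rw [hRs, hRs]
      have hsp' : ∀ j, j ≠ 3 → c j + 1 ≤ (y - e₃) j ∧ (y - e₃) j + 2 ≤ c j + b := fun j hj => by
        rw [he₃, if_neg hj]; simpa using hsp j hj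
      have hy3' : (y - e₃) 3 = c 3 + n := by rw [he₃, if_pos rfl]; push_cast at hy3 ⊢; omega
      have hyb' : (y - e₃) 3 + 2 ≤ c 3 + b := by rw [he₃, if_pos rfl]; omega
      rw [ih (y - e₃) hsp' hy3' hyb']
      -- the link `(y − e₃, 3)` is a tree link
      have hmem : (y - e₃, (3 : Fin 4)) ∈ Λ := hlink (y - e₃) hsp' (by rw [hy3']; omega) (by omega)
      have htree : (y - e₃, (3 : Fin 4)) ∈ Λ.filter (fun ℓ => ℓ.2 = 3 ∧
          ∀ j, c j + 1 ≤ (ℓ.1 + Pi.single 3 1 : Fin 4 → ℤ) j ∧ (ℓ.1 + Pi.single 3 1 : Fin 4 → ℤ) j + 2 ≤ c j + b) := by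
        rw [Finset.mem_filter]
        refine ⟨hmem, rfl, fun j => ?_⟩
        show c j + 1 ≤ (y - e₃ + e₃) j ∧ (y - e₃ + e₃) j + 2 ≤ c j + ↑b
        rw [sub_add_cancel]
        by_cases hj : j = 3
        · subst hj; constructor <;> omega
        · exact hsp j hj
      rw [glueWith_apply_mem _ _ _ hmem, glueWith_apply_mem _ _ _ hmem, hζ ⟨_, hmem⟩ htree]
  refine fibreIntegral_exp_neg_mul_one_ge_of_gauge ρ hρ hρU Λ _ g ?_ ?_ ?_ ?_ hβ hr
  · -- (i) measurability
    intro x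
    have hRm : ∀ (n : ℕ) (y : Fin 4 → ℤ), Measurable fun ζ : ↥Λ → G => R ζ n y := by
      intro n
      induction' n with n ih
      · intro y
        have hfun : (fun ζ : ↥Λ → G => R ζ 0 y) = fun _ => 1 := rfl
        rw [hfun]; exact measurable_const
      · intro y
        have hfun : (fun ζ : ↥Λ → G => R ζ (n + 1) y) = fun ζ => R ζ n (y - e₃) * glueWith Λ ζ (fun _ => 1) (y - e₃, 3) := rfl
        rw [hfun]
        exact (ih _).mul ((measurable_pi_apply (y - e₃, (3 : Fin 4))).comp (measurable_glueWith Λ (fun _ => (1 : G))))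
    by_cases hx : D x
    · simp only [g, if_pos hx]; exact hRm _ _
    · simp only [g, if_neg hx]; exact measurable_const
  · -- (ii) `g` is determined by the tree coordinates
    intro ζ ζ' hζ
    funext x
    by_cases hx : D x
    · simp only [g, if_pos hx]
      have h3 := hx 3
      exact hRT ζ ζ' hζ _ x (fun j _ => hx j) (by omega) h3.2
    · simp only [g, if_neg hx]
  · -- (iii) exterior links have no deep endpoint
    intro ζ e he
    obtain ⟨x, i⟩ := e
    have hD1 : ¬D x := by
      intro hx
      refine he ?_
      rw [hΛ, mem_cubeEdges_iff_forall]
      refine ⟨fun j => ?_, fun j => ?_⟩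
      · have := hx j; omega
      · have := hx j; split_ifs <;> omega
    have hD2 : ¬D (x + Pi.single i 1) := by
      intro hx
      refine he ?_
      rw [hΛ, mem_cubeEdges_iff_forall]
      refine ⟨fun j => ?_, fun j => ?_⟩
      · have := hx j
        simp only [Pi.add_apply, Pi.single_apply] at this
        split_ifs at this <;> omega
      · have := hx j
        simp only [Pi.add_apply, Pi.single_apply] at this
        split_ifs at this ⊢ <;> omega
    exact ⟨by simp only [g, if_neg hD1], by simp only [g, if_neg hD2]⟩
  · -- (iv) the tree links are killed
    intro ζ ℓ hℓ
    rw [Finset.mem_filter] at hℓ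
    obtain ⟨hℓΛ, h3, hdeep⟩ := hℓ
    obtain ⟨y, i⟩ := ℓ
    simp only at h3
    subst h3
    change D (y + e₃) at hdeep
    have hyB := ((mem_cubeEdges_iff_forall c b y 3).1 (by rw [← hΛ]; exact hℓΛ)).1
    -- `g (y + e₃) = g y · ζ(y, 3)`
    have hsp : ∀ j, j ≠ 3 → c j + 1 ≤ y j ∧ y j + 2 ≤ c j + b := fun j hj => by
      have := hdeep j; rw [he₃', if_neg hj, add_zero] at this; exact this
    have hd3 := hdeep 3
    rw [he₃', if_pos rfl] at hd3
    set k : ℕ := (y 3 + 1 - c 3).toNat with hk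
    have hk1 : k = (y 3 - c 3).toNat + 1 := by have := (hyB 3).1; omega
    have hgx : g ζ (y + e₃) = R ζ ((y 3 - c 3).toNat) y * glueWith Λ ζ (fun _ => 1) (y, 3) := by
      simp only [g, if_pos hdeep]
      rw [he₃', if_pos rfl, ← hk, hk1, hRs, add_sub_cancel_right]
    have hgy : g ζ y * glueWith Λ ζ (fun _ => 1) (y, 3) = g ζ (y + e₃) := by
      rw [hgx]
      by_cases hy : D y
      · simp only [g, if_pos hy]
      · simp only [g, if_neg hy]
        -- then `y₃ = c₃`, and the column product is empty
        have hy3 : y 3 = c 3 := by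
          by_contra hne
          refine hy fun j => ?_
          by_cases hj : j = 3
          · subst hj; have := (hyB 3).1; omega
          · exact hsp j hj
        have h0 : (y 3 - c 3).toNat = 0 := by rw [hy3]; simp
        rw [h0, hR0]
    show g ζ y * glueWith Λ ζ (fun _ => 1) (y, 3) * (g ζ (y + Pi.single 3 1))⁻¹ = 1
    rw [hgy]
    exact mul_inv_cancel _

end Cube

end Summit.QuantumFields.YangMills.Cruxes.UVSeamRec.ClassicalResponse.ColdWall

end
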